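import Summits.Langlands.Langlands.Theorems.IrreducibilityBySelfDualityReciprocityUpToIrreducibilityRankOneFiniteInertiaAway
import Literature.NumberTheory.GaloisRepresentations.UnramifiedDatum
import Literature.NumberTheory.GaloisRepresentations.WeilDeligneOfGalois
import HarnessLib

/-!
# Line `Sketch` for the crux `ReciprocityUpToIrreducibility` (item stmt-Langlands-14328), wave N15-A:
# in rank one, `ρ|_{W_{K_v}}` is trivial on an open subgroup of inertia at every place `v ∤ ℓ`

Support file (closes nothing; stub `stub_rankOne_isContinuousRep_weilRestrict_away` of the registered
skeleton of line `Sketch`, continuation lead c10).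

Let `K` be a number field, `ℓ` a prime, `ρ : Γ_K →ₜ* GL_1(ℚ̄_ℓ)` a continuous character and `v ∤ ℓ`
a finite place.  Then the restriction `ρ|_{W_{K_v}}` of the local representation `ρ|_{Γ_{K_v}}`
(`FramedGaloisRep.toLocal`) to the Weil group, viewed as a representation on the line
`Fin 1 → ℚ̄_ℓ` (`FramedRep.weilRestrict`), is *continuous for the discrete topology*
(`WeilGroup.IsContinuousRep`): it is trivial on an open subgroup `U ≤ I(W_{K_v})`.  This is the
hypothesis `hc` of c7's `rankOne_localGlobalCompatibleAt_away_iff_artinCompatible`, previously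
available only for open-kernel `ρ` (`isContinuousRep_weilRestrict_toLocal_of_isOpen_ker`); here it is
proved for EVERY continuous rank-one `ℓ`-adic `ρ`.

Proof: the rank-one case of Grothendieck's `ℓ`-adic monodromy theorem, PROVED in the tree
(`FramedRep.exists_isOpen_isNilpotent_sub_one_holds`, Serre–Tate 1968, Appendix; Deligne, Antwerp II,
§8.4.2), applied to the continuous restriction `ρ|_{W_{K_v}}` (`WeilGroup.continuous_toAbsGalois_holds`;
`‖q_v‖_ℓ = 1` because `v ∤ ℓ`, `GaloisRepOfRegularAlgebraic.norm_residueCard_eq_one` and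
`residueFieldCard_adicCompletion_eq`): there is an open subgroup `U` of the inertia of `W_{K_v}` on
which `ρ(u) - 1` is a nilpotent `1 × 1` matrix, hence `0` (`Ladic.pow_eq_zero_of_isNilpotent`), so
`ρ(u) = 1`, and the endomorphism `ρ|_{W_{K_v}}(u)` of `Fin 1 → ℚ̄_ℓ` is `x ↦ ρ(u) *ᵥ x = x`
(`FramedRep.weilRestrict_apply_apply`; this is c7's `weilRestrict_eq_one_of_toWeilGroupHom_eq_one` of
`…RamifiedPlaces.lean`, used inline rather than imported because that module's import closure contains
`Theses.IrreducibilityBySelfDuality`, not coherent on the farm at the time of writing).  This is exactly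
the first half of c9's `finite_image_absInertia_of_rankOne` (wave N14-A), stopped before finiteness.
Design: the imports avoid every `Theses` module (c9's N14-A file, whose problem-side closure is the
`GaloisRepOfRegularAlgebraicLocalRigidity` file, plus two Literature files).  No definitions; standard
axioms; no named fact is assumed.

References: J.-P. Serre, J. Tate, *Good reduction of abelian varieties*, Ann. of Math. 88 (1968),
Appendix [SerreTate1968]; P. Deligne, *Les constantes des équations fonctionnelles des fonctions L*,
Antwerp II, LNM 349 (1973), §8.4.2 [DeligneAntwerpII1973]; J. Tate, *Number theoretic background*,
Corvallis 1979, (1.4.1), (4.1.2), (4.2.1) [TateCorvallis1979].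
-/

noncomputable section

set_option linter.dupNamespace false -- project-wide option (lakefile weak.linter.dupNamespace); `Summit.Langlands.Langlands` is the mandated namespace

open scoped NumberField Classical Polynomial MatrixGroups
open Filter IsDedekindDomain Polynomial Field
open Literature.NumberTheory.Automorphic Literature.NumberTheory.GaloisRepresentations
open Literature.NumberTheory.GaloisRepresentations.IsNonarchimedeanLocalField (residueFieldCard)
open Summit.Langlands

namespace Summit.Langlands.Langlands.Theorems.ReciprocityUpToIrreducibility

/-! ## 1. Local: Grothendieck's monodromy theorem in rank one, as discrete continuity of `ρ|_{W_F}` -/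

section Local

open WeilGroup

variable {F : Type} [Field F] [ValuativeRel F] [TopologicalSpace F] [IsNonarchimedeanLocalField F]
  {E : Type} [NontriviallyNormedField E]

/-- **Grothendieck's monodromy theorem in rank one: `ρ|_{W_F}` kills an open subgroup of inertia.**
Let `E` be a non-trivially normed field in which the residue cardinality `q` of `F` has norm `1`
(e.g. `ℚ̄_ℓ`, `ℓ ∤ q`) and `ρ : Γ_F →ₜ* GL_1(E)` a continuous character.  Then there is an open
subgroup `U` of the inertia group of `W_F` with `ρ(u) = 1` for all `u ∈ U`: by Grothendieck's
quasi-unipotence theorem (`FramedRep.exists_isOpen_isNilpotent_sub_one_holds`) applied to the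
continuous restriction `ρ|_{W_F}` (`WeilGroup.continuous_toAbsGalois_holds`), `ρ(u) - 1` is a
nilpotent `1 × 1` matrix, hence `0` (`Ladic.pow_eq_zero_of_isNilpotent`), for `u` in an open
subgroup `U` of inertia.
[cite: SerreTate1968, Appendix (ℓ-adic monodromy)] [cite: DeligneAntwerpII1973, §8.4.2] -/
-- adapted from c9's `finite_image_absInertia_of_rankOne` (…RankOneFiniteInertiaAway.lean), first half
theorem exists_isOpen_forall_toWeilGroupHom_eq_one_of_rankOne (hq : ‖(residueFieldCard F : E)‖ = 1)
    (ρ : FramedRep (absoluteGaloisGroup F) E 1) :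
    ∃ U : Subgroup (WeilGroup F), U ≤ inertia F ∧ IsOpen (U : Set (WeilGroup F)) ∧
      ∀ u ∈ U, ρ.toWeilGroupHom u = 1 := by
  -- the continuous restriction of `ρ` to the Weil group
  let ι : WeilGroup F →ₜ* absoluteGaloisGroup F := ⟨toAbsGalois F, continuous_toAbsGalois_holds F⟩
  let ρW : FramedRep (WeilGroup F) E 1 := ρ.comp ι
  -- Grothendieck: `ρW` is unipotent, i.e. trivial (rank one), on an open subgroup `U` of inertia
  obtain ⟨U, hUI, hUo, hnil⟩ := FramedRep.exists_isOpen_isNilpotent_sub_one_holds hq ρW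
  refine ⟨U, hUI, hUo, fun u hu => ?_⟩
  have h := Ladic.pow_eq_zero_of_isNilpotent (hnil u hu)
  rw [pow_one, sub_eq_zero] at h
  exact Units.ext h

/-- **Grothendieck's monodromy theorem in rank one, Weil–Deligne form: `ρ|_{W_F}` is continuous for
the discrete topology.**  Under `‖q‖ = 1` in `E`, for every continuous character
`ρ : Γ_F →ₜ* GL_1(E)` the representation `ρ|_{W_F}` of `W_F` on `Fin 1 → E`
(`FramedRep.weilRestrict`) is trivial on an open subgroup of inertia (`WeilGroup.IsContinuousRep`):
`exists_isOpen_forall_toWeilGroupHom_eq_one_of_rankOne`, and `ρ|_{W_F}(u)` acts by `x ↦ ρ(u) *ᵥ x`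
(`FramedRep.weilRestrict_apply_apply`).
[cite: DeligneAntwerpII1973, §8.4.2] [cite: TateCorvallis1979, (4.1.2) and (4.2.1)] -/
theorem isContinuousRep_weilRestrict_of_rankOne (hq : ‖(residueFieldCard F : E)‖ = 1)
    (ρ : FramedRep (absoluteGaloisGroup F) E 1) :
    WeilGroup.IsContinuousRep (ρ.weilRestrict F) := by
  obtain ⟨U, hUI, hUo, hU1⟩ := exists_isOpen_forall_toWeilGroupHom_eq_one_of_rankOne hq ρ
  refine ⟨U, hUI, hUo, fun u hu => LinearMap.ext fun x => ?_⟩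
  -- `ρ|_{W_F}(u) x = ρ(u) *ᵥ x = x` (the computation of c7's `weilRestrict_eq_one_of_toWeilGroupHom_eq_one`,
  -- adapted from `FramedRep.IsLocallyUnramified.isUnramifiedRep_weilRestrict`, UnramifiedDatum.lean)
  have h1 : ρ (toAbsGalois F u) = 1 := hU1 u hu
  rw [FramedRep.weilRestrict_apply_apply, h1, Units.val_one, Matrix.one_mulVec]
  rfl

end Local

/-! ## 2. The registered stub -/

/-- **Registered stub `stub_rankOne_isContinuousRep_weilRestrict_away` of line `Sketch` (crux
stmt-Langlands-14328, wave N15-A): in rank one, `ρ|_{W_{K_v}}` is trivial on an open subgroup of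
inertia at every `v ∤ ℓ`.**  For a number field `K`, a prime `ℓ`, a continuous character
`ρ : Γ_K →ₜ* GL_1(ℚ̄_ℓ)` and a finite place `v ∤ ℓ`, the representation
`(ρ|_{Γ_{K_v}})|_{W_{K_v}}` on `Fin 1 → ℚ̄_ℓ` is continuous for the discrete topology
(`WeilGroup.IsContinuousRep`): `‖q_v‖_ℓ = 1` (`GaloisRepOfRegularAlgebraic.norm_residueCard_eq_one`,
`residueFieldCard_adicCompletion_eq`) and `isContinuousRep_weilRestrict_of_rankOne` (Grothendieck's
quasi-unipotence theorem `FramedRep.exists_isOpen_isNilpotent_sub_one_holds` on `ρ|_{W_{K_v}}`; a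
unipotent scalar is `1`).
[cite: SerreTate1968, Appendix (ℓ-adic monodromy)] [cite: DeligneAntwerpII1973, §8.4.2]
[cite: TateCorvallis1979, (4.1.2), (4.2.1)] -/
theorem stub_rankOne_isContinuousRep_weilRestrict_away :
    ∀ (K : Type) [Field K] [NumberField K] (ℓ : ℕ) [Fact ℓ.Prime]
      (ρ : FramedGaloisRep K (PadicAlgCl ℓ) 1) (v : HeightOneSpectrum (𝓞 K)),
      ((ℓ : ℕ) : 𝓞 K) ∉ v.asIdeal →
      WeilGroup.IsContinuousRep ((ρ.toLocal v).weilRestrict (v.adicCompletion K)) := by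
  intro K _ _ ℓ _ ρ v hv
  have hq1 : ‖((residueFieldCard (v.adicCompletion K) : ℕ) : PadicAlgCl ℓ)‖ = 1 := by
    rw [residueFieldCard_adicCompletion_eq K v]
    exact GaloisRepOfRegularAlgebraic.norm_residueCard_eq_one v hv
  exact isContinuousRep_weilRestrict_of_rankOne hq1 (ρ.toLocal v)

end Summit.Langlands.Langlands.Theorems.ReciprocityUpToIrreducibility

end
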